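import Summits.HodgeConjecture.HodgeConjecture.Theorems.Ring2AtlasCMFivefoldsCyclotomic33
import Summits.HodgeConjecture.HodgeConjecture.Theorems.Ring2AtlasUnitaryProductCellsNonVacuity
import Summits.HodgeConjecture.CorCM.Model.CMAbelianVarietyRealisedHolds
import HarnessLib

set_option linter.dupNamespace false

/-!
# Ring 2 · atlas-2 — the open `g = 6` cell `E × Y₅` (`HodgePowersOfCMEllipticTimesUnitaryFivefold`) is NOT VACUOUS

HONEST FRAMING: research route conditional on HC_CM; not a corollary; Q11.4-sentence-2 already refuted in dim ≥ 3.

Cell `pub-hodge-ring2`, seat `pub-hodge-ring2-atlas-2` (generation 52). Companion of `Ring2AtlasSixfolds`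
(generation 3) §3, which types the OPEN `g = 6` sub-row (c′′) of AV-HODGE-ATLAS.md as
`HodgePowersOfCMEllipticTimesUnitaryFivefold : ∀ E Y φ ψ d, 0 < d → dim E = 1 → dim Y = 5 → Y simple →
φ ≫ φ = -d → ψ ≫ ψ = -d → ∀ N, HodgeConjectureFor (dim (E × Y)ⁿ) (E × Y)ⁿ` (KIND (c) OPEN; no closure is
claimed anywhere), and of `Ring2AtlasUnitaryProductCellsNonVacuity` (generation 50), which did the same service
for the `g = 7` cell `E × Y₆` and proved that `HC_CM` decides exactly the CM locus of the present cell
(`hodgePowersOfCMEllipticTimesUnitaryFivefold_cmLocus_of_cmAbelianHodge`). A cell over an EMPTY hypothesis list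
would be true for the wrong reason; this file inhabits the list, with `d = 3`, `k = ℚ(√-3)`:

* `E`, `φ ≫ φ = -3`: the CM elliptic curve of `exists_cmEllipticCurve_sqrtNegThree_of_cmAbelianVarietyRealised`
  (generation 50, used by name);
* `Y`, `ψ ≫ ψ = -3` (`exists_isSimpleCMFivefold_sqrtNegThree_of_cmAbelianVarietyRealised`): any realisation of
  the PRIMITIVE CM type `(K; S)` of the cyclic CM field `K = ℚ(ζ₃₃)^⟨ζ ↦ ζ¹⁰⟩` of degree `10` (companion module
  `Ring2AtlasCMFivefoldsCyclotomic33`: `Cyclotomic33.K10`, a CM field containing `ω = ζ₃₃¹¹`, a primitive cube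
  root of unity) — `dim Y = [K:ℚ]/2 = 5` (`Motives.schemeDim_eq_holds`), `Y` simple by the primitive-type criterion
  (`ComplexMultiplication.isSimple_of_isCMTypeRealisation_of_primitive`, Shimura 1998 §8.2 Prop. 26, landed
  p239773, with `Cyclotomic33.Φ_primitive` below), of CM type (`isOfCMType_of_isCMTypeRealisation`), and
  `ψ := ι(2ω + 1)` has `ψ ≫ ψ = ι((2ω + 1)²) = -3` (`Cyclotomic3.two_mul_add_one_mul_self`).

So `hodgePowersOfCMEllipticTimesUnitaryFivefold_class_nonempty`: the typed hypothesis list is inhabited (the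
witness lies on the cell's CM LOCUS — both factors of CM type — not in its intended type-IV class `End⁰(Y) = k`;
non-vacuity is a statement about the class, and no Hodge class of the witness is computed). The realisation
record `(h₃) = PicardCM.CMAbelianVarietyRealised` (Shimura 1998 §6.2 Thm. 3) is an explicit ARGUMENT of the
un-primed theorems and is DISCHARGED in the primed ones by the tree theorem
`CorCM.cmAbelianVarietyRealised_holds` (COR-CM, p250116; imported and used by name, not restated); `HC_CM`
(`Theses.RankFourFaces.CMAbelianHodge`, OPEN, stmt-HodgeConjecture-3052) is an explicit ARGUMENT of the one
theorem that uses it (`…_cmLocus_nonempty_of_cmAbelianHodge`), never an axiom.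

## The type and its primitivity (namespace `Cyclotomic33`, pattern of `Ring2AtlasCMSevenfoldsNonVacuity`)

`G = Gal(ℚ(ζ₃₃)/ℚ) = (ℤ/33)^×` (order `20`), `H = {1, 10}`, `Gal(K/ℚ) = G/H` cyclic of order `10`, generated
by the class `ḡ` of `2` (`2` has order `10` mod `33` and `2⁵ = 32 ∉ H`). The exponent set of the type is
Shimura's half-system for a cyclic `F` (§8.4: «We can similarly treat the case where `F` is cyclic over `Q`»):
`T := ⋃_{0 ≤ i ≤ 4} 2^i·H = {1, 2, 4, 7, 8, 10, 14, 16, 20, 28}` (`expT`); `T` is `H`-stable (`core_T10`),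
`T ⊔ 32·T = (ℤ/33)^×` (`core_conj`), and its stabiliser `H' = {γ ∈ G : γT = T}` is EXACTLY `H` (`core_prim`,
`decide +kernel` on the residue table) — Shimura 1998 §8.2 Prop. 26 [held text
`book:shimura1998-abelian-varieties-with-complex-multiplication-modular-functions`, chunk p0081, verbatim]:
«Then `(F; {φᵢ})` is primitive if and only if `H₁ = H'`.» The `Aut(ℂ)`-form of primitivity consumed by the
tree's simplicity criterion (`Φ_primitive`: two embeddings `s, t : K → ℂ` with `τ ∘ s ∈ S ⟺ τ ∘ t ∈ S` for all
`τ ∈ Aut(ℂ)` coincide) follows exactly as in generation 48: extend to `ℚ(ζ₃₃)` with exponents `a, b`, move by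
`Aut(ℂ)` (transitive on embeddings of `ℚ(ζ₃₃)`) to read the hypothesis as `ca ∈ T ⟺ cb ∈ T` for all units `c`,
conclude `b ∈ aH` (`core_prim`), so the two extensions differ by `σ^j ∈ H`, which fixes `K`. (`T` is mixed
mod `3` — residues `1, 2` both occur — so the type is not induced from `ℚ(ω)`, consistent with primitivity; not
used.)

WHAT THIS IS NOT: no cell `def`, KIND, row word or count of `Ring2AtlasSixfolds` / AV-HODGE-ATLAS.md changes;
the cell stays OPEN; nothing is asserted about Hodge classes on `E × Y` beyond the CM-locus consequence of the
HYPOTHESIS `HC_CM` already proved in generation 50; no `sorry`, no new axiom.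

References: [Shimura1998] §8.2 Prop. 26 (p. 61), §8.4 Example (1) and sequel (p. 64), §6.2 Thm. 3 (pp. 41–42);
[vanGeemen1994HodgeAV] 4.7, Def. 4.9 (type-IV Weil classes on `E × Y`-type products, the cell's source);
[MoonenZarhin1999LowDim] §5 (the `g = 6` exceptional list); [Milne1999] §7 (H) (`HC_CM`).
-/

noncomputable section

open Polynomial NumberField CategoryTheory

namespace Summit.HodgeConjecture.HodgeConjecture.Ring2.Atlas

open Literature.AlgebraicGeometry Literature.AlgebraicGeometry.Motives
open Literature.AlgebraicGeometry.HodgeTheory (HodgeConjectureFor)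
open Literature.AlgebraicGeometry.ComplexMultiplication
open Literature.NumberTheory.ComplexMultiplication
open Literature.NumberTheory.Automorphic (PicardCM.CMAbelianVarietyRealised)
open Literature.AlgebraicGeometry.Milne1999 (IsOfCMType)
open Summit.HodgeConjecture.CorCM (cmAbelianVarietyRealised_holds)

namespace Cyclotomic33

/-! ### The CM type `Φ` of `K`, read on `ℚ(ζ₃₃)`: exponents in `T` -/

/-- The exponent set of the type, `T ⊂ (ℤ/33)^×`: the union of the five `H`-cosets `2^i·H`, `0 ≤ i ≤ 4`
(`H = {1, 10}`), i.e. the first half `{ḡ⁰, …, ḡ⁴}` of the cyclic group `Gal(K/ℚ) = (ℤ/33)^×/H ≅ ℤ/10` in the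
generator `ḡ = 2̄` — Shimura's half-system for a field cyclic over `ℚ`. Listed as residues.
[cite: Shimura1998, §8.4 Example (1), p. 64] -/
def expT : List ℕ := [1, 2, 4, 7, 8, 10, 14, 16, 20, 28]

/-- `T` is a union of `H`-cosets: `a·10^j ∈ T ⟺ a ∈ T` (membership read on residues mod `33`). Decided by
the kernel. [folklore] -/
theorem core_T10 : ∀ a : ℕ, a < 33 → ∀ j : ℕ, j < 2 → ((a * 10 ^ j) % 33 ∈ expT ↔ a % 33 ∈ expT) := by
  decide +kernel

/-- `T ⊔ (−T) = (ℤ/33)^×`: for a unit `a`, exactly one of `a`, `−a ≡ 32a` lies in `T` («no two of the `φᵢ`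
are complex conjugate of each other»). Decided by the kernel. [folklore] -/
theorem core_conj : ∀ a : ℕ, a < 33 → a.Coprime 33 → (a % 33 ∈ expT ↔ ¬ (32 * a) % 33 ∈ expT) := by
  decide +kernel

/-- `(ℤ/33)^×` is a group of order `20`: `a · (a¹⁹ b) ≡ b (mod 33)` for `a` prime to `33` (Euler).
Decided by the kernel. [folklore] -/
theorem core_inv : ∀ a : ℕ, a < 33 → a.Coprime 33 → ∀ b : ℕ, b < 33 →
    (a * (a ^ 19 * b % 33)) % 33 = b := by
  decide +kernel

/-- Products of units mod `33` are units. Decided by the kernel. [folklore] -/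
theorem core_coprime : ∀ c : ℕ, c < 33 → c.Coprime 33 → ∀ a : ℕ, a < 33 → a.Coprime 33 →
    Nat.Coprime (c * a) 33 := by
  decide +kernel

set_option synthInstance.maxSize 4096 in
set_option synthInstance.maxHeartbeats 400000 in
/-- **The arithmetic heart of primitivity** (Shimura's `H' = H₁`, §8.2 Prop. 26, for this type): if two
units `a, b` mod `33` satisfy `ca ∈ T ⟺ cb ∈ T` for every unit `c`, then `b ∈ aH = {a, 10a}` — the
stabiliser `{γ : γT = T}` of `T` in `(ℤ/33)^×` is exactly `H` (an «interval» `{ḡ⁰, …, ḡ⁴}` of `ℤ/10` has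
trivial stabiliser), applied to `b a⁻¹`. Decided by the kernel on the full residue table.
[cite: Shimura1998, §8.2 Prop. 26, p. 61; §8.4, p. 64] -/
theorem core_prim : ∀ a : ℕ, a < 33 → a.Coprime 33 → ∀ b : ℕ, b < 33 → b.Coprime 33 →
    (∀ c : ℕ, c < 33 → c.Coprime 33 → ((c * a) % 33 ∈ expT ↔ (c * b) % 33 ∈ expT)) →
    (b = a ∨ b = a * 10 % 33) := by
  decide +kernel

/-- **The type** `S ⊂ Hom(K, ℂ)`: the complex embeddings of `K` one (equivalently every) extension of which
to `ℚ(ζ₃₃)` sends `ζ` to `μ^a` with `a ∈ T` (well defined because `T` is `H`-stable, `mem_typeSet_iff`).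
[cite: Shimura1998, §8.4 Example (1), p. 64] -/
def typeSet : Set (K10 →+* ℂ) :=
  {φ | ∃ f : L33 →+* ℂ, f.comp (algebraMap K10 L33) = φ ∧ ∃ a : ℕ, a < 33 ∧ f ζ = μ ^ a ∧ a % 33 ∈ expT}

/-- Membership in the type is read off the exponent of ANY extension to `ℚ(ζ₃₃)` (two extensions differ by
an element of `H`, and `T` is `H`-stable). [folklore] -/
theorem mem_typeSet_iff {φ : K10 →+* ℂ} {f : L33 →+* ℂ} (hf : f.comp (algebraMap K10 L33) = φ)
    {n : ℕ} (hn : f ζ = μ ^ n) : φ ∈ typeSet ↔ n % 33 ∈ expT := by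
  constructor
  · rintro ⟨f', hf', a, ha, hf'a, hTa⟩
    obtain ⟨j, hj, hjζ⟩ := exists_exponent_of_comp_eq (hf'.trans hf.symm) hf'a
    have hmod : n % 33 = (a * 10 ^ j) % 33 :=
      μ_pow_inj (Nat.mod_lt _ (by norm_num)) (Nat.mod_lt _ (by norm_num))
        (by rw [← μ_pow_mod, ← μ_pow_mod, ← hn, hjζ])
    rw [hmod, core_T10 a ha j hj]
    exact hTa
  · intro hT
    exact ⟨f, hf, n % 33, Nat.mod_lt _ (by norm_num), by rw [hn, μ_pow_mod n], by rwa [Nat.mod_mod]⟩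

/-- **`(K; S)` is a CM type**: an embedding lies in `S` iff its complex conjugate does not (the conjugate of
an extension extends the conjugate and has exponent `32a = −a`, and `T ⊔ (−T) = (ℤ/33)^×`).
[cite: Shimura1998, §8.4 Example (1), p. 64] -/
theorem typeSet_isCMType (φ : K10 →+* ℂ) : φ ∈ typeSet ↔ ComplexEmbedding.conjugate φ ∉ typeSet := by
  obtain ⟨f, hf⟩ := exists_extension φ
  obtain ⟨a, ha, hac, hfa⟩ := exists_apply_ζ_eq f
  have hconj : (ComplexEmbedding.conjugate f).comp (algebraMap K10 L33) = ComplexEmbedding.conjugate φ := by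
    ext x
    have hx := RingHom.congr_fun hf x
    rw [RingHom.comp_apply] at hx
    rw [RingHom.comp_apply, ComplexEmbedding.conjugate_coe_eq, hx, ← ComplexEmbedding.conjugate_coe_eq]
  have h32 : ComplexEmbedding.conjugate f ζ = μ ^ (32 * a) := by
    rw [ComplexEmbedding.conjugate_coe_eq, hfa, map_pow, conj_μ, ← pow_mul]
  rw [mem_typeSet_iff hf hfa, mem_typeSet_iff hconj h32]
  exact core_conj a ha hac

/-- **The CM type `(K; S)` of the witness** as a `Motives.CMType`: `K = ℚ(ζ₃₃)^⟨σ⟩` cyclic of degree `10`,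
`S` = the five embeddings whose extensions have exponent in `T`. [cite: Shimura1998, §8.4 Example (1), p. 64] -/
def Φ : CMType K10 := ⟨typeSet, typeSet_isCMType⟩

/-- **The CM type `(K; S)` is PRIMITIVE** (Shimura 1998 §8.2 Prop. 26: `(F; {φᵢ})` is primitive iff
`H₁ = H'`; here `H₁ = H = ⟨σ⟩` and `H' = {γ : γT = T} = H` by `core_prim`), in the `Aut(ℂ)`-form consumed by
the tree's simplicity criterion `ComplexMultiplication.isSimple_of_isCMTypeRealisation_of_primitive`: two complex
embeddings `s, t` of `K` with `τ ∘ s ∈ S ⟺ τ ∘ t ∈ S` for all `τ ∈ Aut(ℂ)` coincide. Proof as in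
`Cyclotomic43.Φ_primitive`: extend `s, t` to `fₛ, fₜ : ℚ(ζ₃₃) → ℂ` with exponents `a, b`; moving `fₛ` to the
embedding `ζ ↦ μ^{ca}` by some `τ ∈ Aut(ℂ)` (`exists_ringEquiv_comp_eq`) turns the hypothesis into
`ca ∈ T ⟺ cb ∈ T` for every unit `c` (`mem_typeSet_iff`), so `b ≡ a·10^j` (`core_prim`), `fₜ = fₛ ∘ σ^j`
(`ringHom_ext_ζ`), and `σ^j ∈ H` fixes `K` pointwise, whence `t = s`.
[cite: Shimura1998, §8.2 Prop. 26, p. 61; §8.4 Example (1), p. 64] -/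
theorem Φ_primitive (s t : K10 →+* ℂ)
    (hst : ∀ τ : ℂ ≃+* ℂ, ((τ : ℂ →+* ℂ).comp s ∈ Φ.1 ↔ (τ : ℂ →+* ℂ).comp t ∈ Φ.1)) : s = t := by
  obtain ⟨fs, hfs⟩ := exists_extension s
  obtain ⟨ft, hft⟩ := exists_extension t
  obtain ⟨a, ha, hac, hfsa⟩ := exists_apply_ζ_eq fs
  obtain ⟨b, hb, hbc, hftb⟩ := exists_apply_ζ_eq ft
  -- `ft ζ` is a power of `fs ζ`
  obtain ⟨k, hk⟩ : ∃ k : ℕ, (a * k) % 33 = b := ⟨a ^ 19 * b % 33, core_inv a ha hac b hb⟩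
  have hftζ : ft ζ = (fs ζ) ^ k := by
    rw [hftb, hfsa, ← pow_mul, μ_pow_mod (a * k), hk]
  -- the pattern hypothesis, read on exponents
  have key : ∀ c : ℕ, c < 33 → c.Coprime 33 → ((c * a) % 33 ∈ expT ↔ (c * b) % 33 ∈ expT) := by
    intro c hc hcc
    obtain ⟨g, hg⟩ := exists_embedding_apply_ζ_eq (core_coprime c hc hcc a ha hac)
    obtain ⟨τ, hτ⟩ := exists_ringEquiv_comp_eq fs g
    have h1 : ((τ : ℂ →+* ℂ).comp fs) ζ = μ ^ (c * a) := by
      simp only [RingHom.coe_comp, RingHom.coe_coe, Function.comp_apply, hτ, hg]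
    have h2 : ((τ : ℂ →+* ℂ).comp ft) ζ = μ ^ (c * a * k) := by
      simp only [RingHom.coe_comp, RingHom.coe_coe, Function.comp_apply, hftζ, map_pow, hτ, hg, ← pow_mul]
    have hmod : (c * a * k) % 33 = (c * b) % 33 := by
      rw [mul_assoc, Nat.mul_mod, hk, Nat.mul_mod c b, Nat.mod_eq_of_lt hb]
    have e1 : ((τ : ℂ →+* ℂ).comp fs).comp (algebraMap K10 L33) = (τ : ℂ →+* ℂ).comp s := by
      rw [RingHom.comp_assoc, hfs]
    have e2 : ((τ : ℂ →+* ℂ).comp ft).comp (algebraMap K10 L33) = (τ : ℂ →+* ℂ).comp t := by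
      rw [RingHom.comp_assoc, hft]
    have hτst := hst τ
    change ((τ : ℂ →+* ℂ).comp s ∈ typeSet ↔ (τ : ℂ →+* ℂ).comp t ∈ typeSet) at hτst
    rw [mem_typeSet_iff e1 h1, mem_typeSet_iff e2 h2, hmod] at hτst
    exact hτst
  obtain ⟨j, hjb⟩ : ∃ j : ℕ, b = (a * 10 ^ j) % 33 := by
    rcases core_prim a ha hac b hb hbc key with h | h
    · exact ⟨0, by rw [pow_zero, mul_one, Nat.mod_eq_of_lt ha]; exact h⟩
    · exact ⟨1, by rw [pow_one]; exact h⟩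
  -- hence `ft = fs ∘ σ^j`
  have hext : ft = fs.comp ((σ ^ j : L33 ≃ₐ[ℚ] L33) : L33 →+* L33) := by
    apply ringHom_ext_ζ
    simp only [RingHom.coe_comp, RingHom.coe_coe, Function.comp_apply]
    rw [σ_pow_ζ, map_pow, hfsa, hftb, ← pow_mul, hjb, ← μ_pow_mod]
  -- and `σ^j ∈ H` fixes `K` pointwise
  have hmem : σ ^ j ∈ IntermediateField.fixingSubgroup K10 := by
    rw [fixingSubgroup_K10]
    exact Subgroup.npow_mem_zpowers σ j
  rw [IntermediateField.mem_fixingSubgroup_iff] at hmem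
  refine RingHom.ext fun x ↦ ?_
  have hsx : s x = fs x := by rw [← hfs]; rfl
  have htx : t x = ft x := by rw [← hft]; rfl
  rw [hsx, htx, hext, RingHom.comp_apply]
  exact congrArg fs (hmem _ x.2).symm

/-- **The same, in the tree's group-theoretic sense**: for any base embedding `s₀`, the type is
`IsPrimitive (ℂ ≃+* ℂ) Φ s₀` (Shimura's `H₁ = H'`, `ReflexType.IsPrimitive`), via the tree's
`isPrimitive_ringEquiv_complex_iff`. [cite: Shimura1998, §8.2 Prop. 26, p. 61] -/
theorem isPrimitive_Φ (s₀ : K10 →+* ℂ) :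
    Literature.NumberTheory.ComplexMultiplication.IsPrimitive (ℂ ≃+* ℂ) Φ.1 s₀ :=
  (isPrimitive_ringEquiv_complex_iff Φ s₀).2 Φ_primitive

end Cyclotomic33

/-! ## §1 A simple CM abelian FIVEFOLD with `√-3 ∈ End` -/

open Cyclotomic33 in
/-- **A simple CM abelian fivefold with `√-3 ∈ End`, given `(h₃)`**: any realisation `(Y, ι)` of the primitive
CM type `(K; S)`, `K = ℚ(ζ₃₃)^⟨ζ ↦ ζ¹⁰⟩` the cyclic CM field of degree `10`: `dim Y = [K:ℚ]/2 = 5`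
(`Motives.schemeDim_eq_holds`, `Cyclotomic33.finrank_K10`), `Y` simple (`isSimple_of_isCMTypeRealisation_of_primitive`,
Shimura §8.2 Prop. 26, with `Cyclotomic33.Φ_primitive`), of CM type (`isOfCMType_of_isCMTypeRealisation`), and
`ψ := ι(2ω + 1)`, `ω = ζ¹¹ ∈ K` a primitive cube root of unity (`Cyclotomic33.isPrimitiveRoot_zeta3K`), has
`ψ ≫ ψ = ι((2ω + 1)²) = -3` (`Cyclotomic3.two_mul_add_one_mul_self`).
[cite: Shimura1998, §6.2 Thm. 3, pp. 41–42; §8.2 Prop. 26, p. 61; §8.4, p. 64] [cite: vanGeemen1994HodgeAV, 4.7 and Def. 4.9] -/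
theorem exists_isSimpleCMFivefold_sqrtNegThree_of_cmAbelianVarietyRealised
    (h₃ : PicardCM.CMAbelianVarietyRealised) :
    ∃ (Y : AbelianVariety ℂ) (ψ : Y ⟶ Y), Y.dim = 5 ∧ Y.IsSimple ∧ IsOfCMType Y ∧ ψ ≫ ψ = -(3 • 𝟙 Y) := by
  obtain ⟨A, ι, θ, hA⟩ := h₃ K10 Φ
  have hA' : IsCMTypeRealisation Φ A ι θ := hA
  have hdim : A.dim = Module.finrank ℚ K10 / 2 := Motives.schemeDim_eq_holds hA'.1
  have hω := isPrimitiveRoot_zeta3K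
  refine ⟨A, ι (2 * hω.toInteger + 1), by rw [hdim, finrank_K10],
    isSimple_of_isCMTypeRealisation_of_primitive hA' Φ_primitive, isOfCMType_of_isCMTypeRealisation hA', ?_⟩
  change ι (2 * hω.toInteger + 1) * ι (2 * hω.toInteger + 1) = -((3 : ℕ) • (1 : End A))
  rw [← map_mul, Cyclotomic3.two_mul_add_one_mul_self hω.toInteger_isPrimitiveRoot, map_neg, map_ofNat,
    nsmul_eq_mul, Nat.cast_ofNat, mul_one]

/-- **The same with `(h₃)` discharged** by the tree theorem `CorCM.cmAbelianVarietyRealised_holds` (COR-CM,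
p250116): a simple CM abelian fivefold with an endomorphism of square `-3` EXISTS, outright. [folklore] -/
theorem exists_isSimpleCMFivefold_sqrtNegThree :
    ∃ (Y : AbelianVariety ℂ) (ψ : Y ⟶ Y), Y.dim = 5 ∧ Y.IsSimple ∧ IsOfCMType Y ∧ ψ ≫ ψ = -(3 • 𝟙 Y) :=
  exists_isSimpleCMFivefold_sqrtNegThree_of_cmAbelianVarietyRealised cmAbelianVarietyRealised_holds

/-! ## §2 Non-vacuity of the `g = 6` cell `HodgePowersOfCMEllipticTimesUnitaryFivefold` -/

/-- **NON-VACUITY OF THE OPEN CELL `g = 6` (powers of `E × Y₅` with multiplication by the same `k`).** Given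
`(h₃)`, the typed hypothesis list of `HodgePowersOfCMEllipticTimesUnitaryFivefold` — `0 < d`, `dim E = 1`,
`dim Y = 5`, `Y` simple, `φ ≫ φ = -d`, `ψ ≫ ψ = -d` — is inhabited, by `d = 3`, `k = ℚ(√-3)`, the CM elliptic curve
of `exists_cmEllipticCurve_sqrtNegThree_of_cmAbelianVarietyRealised` and the fivefold of §1 (both factors of CM
type: the witness lies on the cell's CM locus, NOT in its intended type-IV class `End⁰(Y) = k`). So the cell does
not quantify over an empty class. [cite: Shimura1998, §6.2 Thm. 3, pp. 41–42] [cite: MoonenZarhin1999LowDim, §5] -/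
theorem hodgePowersOfCMEllipticTimesUnitaryFivefold_class_nonempty (h₃ : PicardCM.CMAbelianVarietyRealised) :
    ∃ (E Y : AbelianVariety ℂ) (φ : E ⟶ E) (ψ : Y ⟶ Y) (d : ℕ), 0 < d ∧ E.dim = 1 ∧ Y.dim = 5 ∧ Y.IsSimple ∧
      φ ≫ φ = -(d • 𝟙 E) ∧ ψ ≫ ψ = -(d • 𝟙 Y) ∧ IsOfCMType E ∧ IsOfCMType Y := by
  obtain ⟨E, φ, hE, hEcm, hφ⟩ := exists_cmEllipticCurve_sqrtNegThree_of_cmAbelianVarietyRealised h₃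
  obtain ⟨Y, ψ, hY, hYs, hYcm, hψ⟩ := exists_isSimpleCMFivefold_sqrtNegThree_of_cmAbelianVarietyRealised h₃
  exact ⟨E, Y, φ, ψ, 3, by norm_num, hE, hY, hYs, hφ, hψ, hEcm, hYcm⟩

/-- **The same with `(h₃)` discharged** (`CorCM.cmAbelianVarietyRealised_holds`): the hypothesis list of the open
cell `HodgePowersOfCMEllipticTimesUnitaryFivefold` is inhabited OUTRIGHT. [folklore] -/
theorem hodgePowersOfCMEllipticTimesUnitaryFivefold_class_nonempty' :
    ∃ (E Y : AbelianVariety ℂ) (φ : E ⟶ E) (ψ : Y ⟶ Y) (d : ℕ), 0 < d ∧ E.dim = 1 ∧ Y.dim = 5 ∧ Y.IsSimple ∧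
      φ ≫ φ = -(d • 𝟙 E) ∧ ψ ≫ ψ = -(d • 𝟙 Y) ∧ IsOfCMType E ∧ IsOfCMType Y :=
  hodgePowersOfCMEllipticTimesUnitaryFivefold_class_nonempty cmAbelianVarietyRealised_holds

/-- **The cell, applied to the witness**: any proof of `HodgePowersOfCMEllipticTimesUnitaryFivefold` yields a CM
abelian SIXFOLD `E × Y` all of whose powers satisfy the Hodge conjecture — the cell's binders are met in order by
the witness of `hodgePowersOfCMEllipticTimesUnitaryFivefold_class_nonempty'` (no hypothesis besides the cell).
[cite: Deligne2000, §1] [cite: Milne1999, §2 p. 54] -/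
theorem hodgePowersOfCMEllipticTimesUnitaryFivefold.exists_cmSixfold_powers
    (h : HodgePowersOfCMEllipticTimesUnitaryFivefold) :
    ∃ X : AbelianVariety ℂ, X.dim = 6 ∧ IsOfCMType X ∧ ∀ N : ℕ, HodgeConjectureFor (X.powSucc N).dim (X.powSucc N).X := by
  obtain ⟨E, Y, φ, ψ, d, hd, hE, hY, hYs, hφ, hψ, hEcm, hYcm⟩ :=
    hodgePowersOfCMEllipticTimesUnitaryFivefold_class_nonempty'
  exact ⟨E.prod Y, by rw [AbelianVariety.dim_prod, hE, hY], hEcm.prod hYcm, h E Y φ ψ d hd hE hY hYs hφ hψ⟩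

/-- **The CM locus of the `g = 6` cell is nonempty, and on it the cell's conclusion holds given `HC_CM`**
(generation 50's `hodgePowersOfCMEllipticTimesUnitaryFivefold_cmLocus_of_cmAbelianHodge` + §2 assembled: the exact
sense in which `HC_CM` bears on this typed cell; `(h₃)` discharged by `CorCM.cmAbelianVarietyRealised_holds`).
[cite: Milne1999, §2 p. 54 and §7 (H)] [cite: Shimura1998, §6.2 Thm. 3, pp. 41–42] -/
theorem hodgePowersOfCMEllipticTimesUnitaryFivefold_cmLocus_nonempty_of_cmAbelianHodge
    (hCM : Theses.RankFourFaces.CMAbelianHodge) :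
    ∃ (E Y : AbelianVariety ℂ) (φ : E ⟶ E) (ψ : Y ⟶ Y) (d : ℕ), 0 < d ∧ E.dim = 1 ∧ Y.dim = 5 ∧ Y.IsSimple ∧
      φ ≫ φ = -(d • 𝟙 E) ∧ ψ ≫ ψ = -(d • 𝟙 Y) ∧ IsOfCMType Y ∧
      ∀ N : ℕ, HodgeConjectureFor ((E.prod Y).powSucc N).dim ((E.prod Y).powSucc N).X := by
  obtain ⟨E, Y, φ, ψ, d, hd, hE, hY, hYs, hφ, hψ, -, hYcm⟩ :=
    hodgePowersOfCMEllipticTimesUnitaryFivefold_class_nonempty'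
  exact ⟨E, Y, φ, ψ, d, hd, hE, hY, hYs, hφ, hψ, hYcm,
    hodgePowersOfCMEllipticTimesUnitaryFivefold_cmLocus_of_cmAbelianHodge hCM E Y φ ψ d hd hE hY hYs hφ hψ hYcm⟩

end Summit.HodgeConjecture.HodgeConjecture.Ring2.Atlas

end
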